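import Summits.Ventures.PercRepro.RankLevelSetHallRepair

/-!
# PercRepro — THE TOURNAMENT OF REPAIRS ONLY NEEDS THE PAIRS WHOSE UNION HAS RANK BELOW `p` (night-1, gen 15; dossier §26.7)

In `spadeInjection_of_repair` (RankLevelSetHallRepair) the tournament condition was asked of EVERY two sets of ℛ.  But two sets
`S₁, S₂` of ℛ can only collide (`S₁ ∪ W S₁ = S₂ ∪ W S₂`) inside a common target of rank `< p`, which contains `S₁ ∪ S₂` — so
pairs with `r(S₁ ∪ S₂) ≥ p` never collide and need no condition.  THIS FILE is the refined statement: the tournament is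
asked only of the pairs with `r(S₁ ∪ S₂) < p` (equivalently, for `S_i` spanning the rank-`q` flats `F_i`: `r(F₁ ∪ F₂) ≤ p − 1`,
i.e. `r(F₁ ∩ F₂) ≥ q − k + 1`; at `k = 2` the two flats must meet in rank `q − 1`).  Census (night-1 g15, tournament.py,
dossier §26.7): with this refinement the kernel rules cover EVERY loopless matroid at the tight layer of `(5,3)` on 8 elements
(276 / 276; the set-level tournament had 255) — at `k = 2` only pairs of flats meeting in rank `q − 1` matter; at `(6,3)` on
9 elements (`k = 3`) the refinement adds nothing (1,118 / 1,203 as before: there the colliding pairs are exactly the ones the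
tournament already had to handle).

* `eRk_union_repair_lt` — `r(S ∪ W S) < p` for a repair set (the bound of RankLevelSetHallRepair, isolated);
* **`spadeInjection_of_repair_rank`** — the refined tournament theorem;
* **`hallUp_of_ncard_eq_of_repair_rank`** — hence the UP-Hall condition of C-044 for every family of members.
Axioms: standard.
-/

namespace PercRepro

open Set Matroid

variable {α : Type} (M : Matroid α) [M.Finite]

/-- A repair set `W S` of size `p − #S` outside `cl S` keeps the rank of `S ∪ W S` below `p` (`#S ≥ q + 1`, `r(S) = q`). -/
theorem eRk_union_repair_lt (p q : ℕ) {S : Set α} (hS : S ∈ rankqOver M p q) {W : Set α} (hWE : W ⊆ M.E)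
    (hWcard : W.ncard = p - S.ncard) : M.eRk (S ∪ W) < (p : ℕ∞) := by
  obtain ⟨-, hrS, hlo, hhi, -⟩ := id hS
  have hEfin : M.E.Finite := M.set_finite M.E
  have hWfin : W.Finite := hEfin.subset hWE
  calc M.eRk (S ∪ W) ≤ M.eRk S + M.eRk W := M.eRk_union_le_eRk_add_eRk _ _
    _ ≤ M.eRk S + W.encard := add_le_add_right (M.eRk_le_encard _) _
    _ = ((q + (p - S.ncard) : ℕ) : ℕ∞) := by
      rw [hrS, ← hWfin.cast_ncard_eq, hWcard]
      push_cast
      rfl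
    _ < (p : ℕ∞) := by exact_mod_cast (show q + (p - S.ncard) < p by omega)

/-- **(♠′) FROM A TOURNAMENT OF REPAIRS, REFINED** (`#E = p + q`): the tournament condition is needed only for the pairs
`S₁, S₂ ∈ ℛ` with `r(S₁ ∪ S₂) < p` — the others cannot share a target. -/
theorem spadeInjection_of_repair_rank (p q : ℕ) (hE : M.E.ncard = p + q) (W : Set α → Set α)
    (hWE : ∀ S ∈ rankqOver M p q, W S ⊆ M.E) (hWcard : ∀ S ∈ rankqOver M p q, (W S).ncard = p - S.ncard)
    (hWcl : ∀ S ∈ rankqOver M p q, ∀ w ∈ W S, M.eRk (insert w S) ≠ (q : ℕ∞))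
    (htour : ∀ S₁ ∈ rankqOver M p q, ∀ S₂ ∈ rankqOver M p q, M.eRk (S₁ ∪ S₂) < (p : ℕ∞) →
      (∀ w ∈ W S₁, M.eRk (insert w S₂) ≠ (q : ℕ∞)) ∨ (∀ w ∈ W S₂, M.eRk (insert w S₁) ≠ (q : ℕ∞))) :
    SpadeInjection M p q := by
  classical
  -- the one-sided step of RankLevelSetHallRepair
  have key : ∀ S₁ ∈ rankqOver M p q, ∀ S₂ ∈ rankqOver M p q,
      S₁ ∪ W S₁ = S₂ ∪ W S₂ → (∀ w ∈ W S₁, M.eRk (insert w S₂) ≠ (q : ℕ∞)) → S₁ = S₂ := by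
    intro S₁ hS₁ S₂ hS₂ hEq havoid
    have h21 : S₂ ⊆ S₁ := by
      intro x hx
      have hx' : x ∈ S₁ ∪ W S₁ := by
        rw [hEq]
        exact Or.inl hx
      rcases hx' with hx1 | hxW
      · exact hx1
      · exfalso
        apply havoid x hxW
        rw [Set.insert_eq_of_mem hx]
        exact hS₂.2.1
    have h12 : S₁ ⊆ S₂ := by
      intro x hx
      by_contra hxS₂
      have hx' : x ∈ S₂ ∪ W S₂ := by
        rw [← hEq]
        exact Or.inl hx
      rcases hx' with hx2 | hxW
      · exact hxS₂ hx2
      · apply hWcl S₂ hS₂ x hxW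
        apply le_antisymm
        · calc M.eRk (insert x S₂) ≤ M.eRk S₁ := M.eRk_mono (Set.insert_subset hx h21)
            _ = (q : ℕ∞) := hS₁.2.1
        · rw [← hS₂.2.1]
          exact M.eRk_mono (Set.subset_insert x S₂)
    exact Set.Subset.antisymm h12 h21
  have hEfin : M.E.Finite := M.set_finite M.E
  refine ⟨fun S => S ∪ W S, ?_, ?_⟩
  · intro S₁ hS₁ S₂ hS₂ hEq
    simp only at hEq
    -- a common target contains `S₁ ∪ S₂` and has rank `< p`
    have hr : M.eRk (S₁ ∪ S₂) < (p : ℕ∞) := by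
      refine lt_of_le_of_lt (M.eRk_mono ?_) (eRk_union_repair_lt M p q hS₁ (hWE S₁ hS₁) (hWcard S₁ hS₁))
      intro x hx
      rcases hx with hx1 | hx2
      · exact Or.inl hx1
      · have : x ∈ S₂ ∪ W S₂ := Or.inl hx2
        rw [← hEq] at this
        exact this
    rcases htour S₁ hS₁ S₂ hS₂ hr with h | h
    · exact key S₁ hS₁ S₂ hS₂ hEq h
    · exact (key S₂ hS₂ S₁ hS₁ hEq.symm h).symm
  · intro S hS
    obtain ⟨hSE, hrS, hlo, hhi, -⟩ := id hS
    have hWS := hWE S hS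
    have hWc := hWcard S hS
    have hSfin : S.Finite := hEfin.subset hSE
    have hWfin : (W S).Finite := hEfin.subset hWS
    have hdisj : Disjoint S (W S) := by
      rw [Set.disjoint_left]
      intro x hxS hxW
      apply hWcl S hS x hxW
      rw [Set.insert_eq_of_mem hxS]
      exact hrS
    have hTcard : (S ∪ W S).ncard = p := by
      rw [Set.ncard_union_eq hdisj hSfin hWfin, hWc]
      omega
    have hWne : (W S).Nonempty := by
      rw [← Set.ncard_pos hWfin, hWc]
      omega
    obtain ⟨w, hw⟩ := hWne
    refine ⟨⟨union_subset hSE hWS, ?_, eRk_union_repair_lt M p q hS hWS hWc, ?_⟩, subset_union_left⟩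
    · have h1 : (q : ℕ∞) ≤ M.eRk (insert w S) := by
        rw [← hrS]
        exact M.eRk_mono (Set.subset_insert w S)
      calc (q : ℕ∞) < M.eRk (insert w S) := lt_of_le_of_ne h1 (Ne.symm (hWcl S hS w hw))
        _ ≤ M.eRk (S ∪ W S) := by
          apply M.eRk_mono
          intro x hx
          rcases hx with rfl | hxS
          · exact Or.inr hw
          · exact Or.inl hxS
    · rw [hTcard]

/-- **C-044, UP FORM, AT THE TIGHT LAYER FROM THE REFINED TOURNAMENT**. -/
theorem hallUp_of_ncard_eq_of_repair_rank (p q : ℕ) (hE : M.E.ncard = p + q) (W : Set α → Set α)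
    (hWE : ∀ S ∈ rankqOver M p q, W S ⊆ M.E) (hWcard : ∀ S ∈ rankqOver M p q, (W S).ncard = p - S.ncard)
    (hWcl : ∀ S ∈ rankqOver M p q, ∀ w ∈ W S, M.eRk (insert w S) ≠ (q : ℕ∞))
    (htour : ∀ S₁ ∈ rankqOver M p q, ∀ S₂ ∈ rankqOver M p q, M.eRk (S₁ ∪ S₂) < (p : ℕ∞) →
      (∀ w ∈ W S₁, M.eRk (insert w S₂) ≠ (q : ℕ∞)) ∨ (∀ w ∈ W S₂, M.eRk (insert w S₁) ≠ (q : ℕ∞)))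
    (𝒜 : Set (Set α)) (h𝒜 : 𝒜 ⊆ cellMembers M p q) :
    phiK p q * (𝒜.ncard : ℚ) ≤ ((upNbhd M p q 𝒜).ncard : ℚ) :=
  hallUp_of_ncard_eq_of_spade M p q hE (spadeInjection_of_repair_rank M p q hE W hWE hWcard hWcl htour) 𝒜 h𝒜

end PercRepro
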